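import Literature.AnabelianGeometry.SemiGraphs.ArithBranchNeVertex
import Literature.AnabelianGeometry.SemiGraphs.ArithBranchGeometricPartAt
import Literature.AnabelianGeometry.SemiGraphs.TemperedCompactInVerticialFinite
import HarnessLib

/-!
# [SemiAnbd] §5, p. 65: `Π^temp_{𝔊,b} ≠ Π^temp_{𝔊,v}` for the produced decomposition data — AT ONE GRAPH
# (φ2 twin of `ArithBranchNeVertex`, proof-only)

Mochizuki, *Semi-graphs of anabelioids*, Publ. RIMS **42** (2006), §5 p. 65 (the branch decomposition groups
`Π^temp_{𝔊,b}` of Thm 5.4) and Thm 3.7 (iii) pp. 40–41 [cite: MochizukiSemiAnbd2006, §5 p.65].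

PROOF-ONLY companion (cell abc-iut, layer L3, L3-lead α107 «CIV-REBIND-L3», CompactInVerticial half; seat
abc-iut-w6-d120; label [mechanical rebind after p442260/p443103; not a cone member]) of abc-iut-w4-d053's
`ArithBranchNeVertex.lean`: its three declarations consume the ∀-countable named fact Thm 3.7 (iii)
`CompactInVerticial` (FACT-LIST F-1732, whose ∀-countable reading is refuted in the kernel at universe `0`,
`ProfiniteSemiGraph.not_compactInVerticial`).  They are re-proved VERBATIM with abc-iut-w4-d075's per-graph
predicate `CompactInVerticialAt 𝒢` (`TemperedCompactInVerticialAt.lean`) at the one graph `𝒢` where the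
original instantiates it — port rule (α4-3) `hCV 𝒢 h𝒢 c ↦ h h𝒢 c`, decl suffix `At`; the (iii)-input
`commensurator_inf_eq_of_edgeLike_le_verticial` is replaced by abc-iut-w4-d040's per-graph
`commensurator_inf_eq_of_edgeLike_le_verticialAt` (`ArithBranchGeometricPartAt.lean`); the (iii)-free
inputs (`arithBrGp_ne_arithVertGp_of`, `not_mem_edgeLikeSubgroups_of_mem_verticialSubgroups`) are reused via
the import.  Then each is DISCHARGED at FINITE semi-graphs (`…_of_finiteGraph`, via
`compactInVerticialAt_of_finiteGraph`, p431007; print p. 41 "since the semi-graphs `𝔾_j` are all finite").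
Original untouched; nothing here asserts Thm 3.7 (iii) for an infinite `𝔾`; nothing here takes a side on
[IUTchIII] Cor. 3.12; typed ≠ discharged.
-/

namespace Literature.AnabelianGeometry.SemiGraphs

namespace ProfiniteSemiGraph

open scoped Pointwise

universe u u'

variable {𝒢 : ProfiniteSemiGraph.{u}}

/-- **Geometric witness for hγ, AT the graph `𝒢`** (φ2 twin of `exists_mem_Hv_not_mem_commensurator_Hb`):
for chart representatives `R`, some element of `Π_v` does NOT commensurate `Π_b` — otherwise
`Π_v = C(Π_b) ∩ Π_v = Π_b` (`commensurator_inf_eq_of_edgeLike_le_verticialAt`, Thm 3.7 (iii) at `𝒢`) would be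
verticial AND edge-like. [cite: MochizukiSemiAnbd2006, Thm 3.7 (iii), pp. 40–41] -/
theorem exists_mem_Hv_not_mem_commensurator_HbAt (h : CompactInVerticialAt 𝒢)
    (h𝒢 : 𝒢.Thm37Hypotheses) (hG : 𝒢.graph.IsGraph) {c : TemperedPiChart 𝒢} (R : ChartRepresentatives c)
    {b : 𝒢.graph.Branch} {v : 𝒢.graph.Vertex} (hbv : 𝒢.graph.abuts b = some v) :
    ∃ x ∈ R.Hv v, x ∉ Subgroup.Commensurable.commensurator (R.Hb b) := by
  by_contra hx
  push Not at hx
  have hle : R.Hv v ≤ Subgroup.Commensurable.commensurator (R.Hb b) := fun x hxv => hx x hxv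
  have heq := commensurator_inf_eq_of_edgeLike_le_verticialAt h h𝒢 hG c (R.Hb_mem b) (R.Hv_mem v)
    (R.Hb_le b v hbv)
  rw [inf_eq_right.mpr hle] at heq
  have hL : R.Hv v ∈ edgeLikeSubgroups c (𝒢.graph.edgeOf b) := heq ▸ R.Hb_mem b
  exact not_mem_edgeLikeSubgroups_of_mem_verticialSubgroups h𝒢 c (R.Hv_mem v) hL

variable {c : TemperedPiChart 𝒢} {Gtp : Type u'} [Group Gtp]

/-- **`Π^temp_{𝔊,b} ≠ Π^temp_{𝔊,v}` AT the graph `𝒢`** (φ2 twin of `arithBrGp_ne_arithVertGp`): for the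
produced arithmetic vertex / branch groups along an injective `ι : π₁^temp(𝒢) ↪ Π^temp_𝔊`, for every branch
`b` abutting to `v` — from Thm 3.7 (iii) AT `𝒢`. [cite: MochizukiSemiAnbd2006, §5, p. 65] -/
theorem arithBrGp_ne_arithVertGpAt (h : CompactInVerticialAt 𝒢) (h𝒢 : 𝒢.Thm37Hypotheses)
    (hG : 𝒢.graph.IsGraph) (R : ChartRepresentatives c) {ι : c.G →* Gtp} (hι : Function.Injective ι)
    {b : 𝒢.graph.Branch} {v : 𝒢.graph.Vertex} (hbv : 𝒢.graph.abuts b = some v) :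
    arithBrGp R ι b ≠ arithVertGp R ι v :=
  arithBrGp_ne_arithVertGp_of R hι hbv (exists_mem_Hv_not_mem_commensurator_HbAt h h𝒢 hG R hbv)

/-- **Menu item hγ at the produced data, AT the graph `𝒢`** (φ2 twin of
`decompositionDataOfChart_brGp_ne_vertGp`; T54 binder shape `∀ b v, D.abut b = some v → D.brGp b ≠ D.vertGp v`
for `D := decompositionDataOfChart R ι`) — from Thm 3.7 (iii) AT `𝒢`. [cite: MochizukiSemiAnbd2006, §5, p. 65] -/
theorem decompositionDataOfChart_brGp_ne_vertGpAt (h : CompactInVerticialAt 𝒢) (h𝒢 : 𝒢.Thm37Hypotheses)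
    (hG : 𝒢.graph.IsGraph) (R : ChartRepresentatives c) (ι : c.G →* Gtp) (hι : Function.Injective ι) :
    ∀ b v, (decompositionDataOfChart R ι).abut b = some v →
      (decompositionDataOfChart R ι).brGp b ≠ (decompositionDataOfChart R ι).vertGp v := by
  intro b v hbv
  rw [decompositionDataOfChart_abut] at hbv
  rw [decompositionDataOfChart_brGp, decompositionDataOfChart_vertGp]
  exact arithBrGp_ne_arithVertGpAt h h𝒢 hG R hι hbv

/-! ### Discharged at FINITE graphs (print p. 41: "the semi-graphs `𝔾_j` are all finite") -/

/-- **Geometric witness for hγ at a FINITE graph** — no binder beyond the hypotheses of Thm 3.7.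
[cite: MochizukiSemiAnbd2006, Thm 3.7 (iii), pp. 40–41] -/
theorem exists_mem_Hv_not_mem_commensurator_Hb_of_finiteGraph [Finite 𝒢.graph.Vertex]
    [Finite 𝒢.graph.Edge] (h𝒢 : 𝒢.Thm37Hypotheses) (hG : 𝒢.graph.IsGraph) (R : ChartRepresentatives c)
    {b : 𝒢.graph.Branch} {v : 𝒢.graph.Vertex} (hbv : 𝒢.graph.abuts b = some v) :
    ∃ x ∈ R.Hv v, x ∉ Subgroup.Commensurable.commensurator (R.Hb b) :=
  exists_mem_Hv_not_mem_commensurator_HbAt compactInVerticialAt_of_finiteGraph h𝒢 hG R hbv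

/-- **`Π^temp_{𝔊,b} ≠ Π^temp_{𝔊,v}` at a FINITE graph** — no binder beyond the hypotheses of Thm 3.7.
[cite: MochizukiSemiAnbd2006, §5, p. 65] -/
theorem arithBrGp_ne_arithVertGp_of_finiteGraph [Finite 𝒢.graph.Vertex] [Finite 𝒢.graph.Edge]
    (h𝒢 : 𝒢.Thm37Hypotheses) (hG : 𝒢.graph.IsGraph) (R : ChartRepresentatives c) {ι : c.G →* Gtp}
    (hι : Function.Injective ι) {b : 𝒢.graph.Branch} {v : 𝒢.graph.Vertex}
    (hbv : 𝒢.graph.abuts b = some v) : arithBrGp R ι b ≠ arithVertGp R ι v :=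
  arithBrGp_ne_arithVertGpAt compactInVerticialAt_of_finiteGraph h𝒢 hG R hι hbv

/-- **Menu item hγ at the produced data of a FINITE graph** — no binder beyond the hypotheses of Thm 3.7.
[cite: MochizukiSemiAnbd2006, §5, p. 65] -/
theorem decompositionDataOfChart_brGp_ne_vertGp_of_finiteGraph [Finite 𝒢.graph.Vertex]
    [Finite 𝒢.graph.Edge] (h𝒢 : 𝒢.Thm37Hypotheses) (hG : 𝒢.graph.IsGraph) (R : ChartRepresentatives c)
    (ι : c.G →* Gtp) (hι : Function.Injective ι) :
    ∀ b v, (decompositionDataOfChart R ι).abut b = some v →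
      (decompositionDataOfChart R ι).brGp b ≠ (decompositionDataOfChart R ι).vertGp v :=
  decompositionDataOfChart_brGp_ne_vertGpAt compactInVerticialAt_of_finiteGraph h𝒢 hG R ι hι

end ProfiniteSemiGraph

end Literature.AnabelianGeometry.SemiGraphs
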